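import Literature.NumberTheory.Automorphic.AutomorphicInductionUnitaryCharacterCubicArchimedean
import Literature.NumberTheory.Automorphic.AutomorphicInductionCharacterCubicProofs
import Literature.NumberTheory.Automorphic.AutomorphicRepsGLOneHeckeCharacter
import Literature.NumberTheory.Automorphic.GLOneArchParameterClauses
import HarnessLib

/-!
# Non-normal cubic automorphic induction with archimedean components: the archimedean clause does
# not depend on the realisation of `θ` on `GL₁(𝔸_E)` (proofs)

Topic `NumberTheory/Automorphic`; a proof file (theorems only: no definition, no named fact, no
instance) attached to the named fact
`Literature.NumberTheory.Automorphic.automorphicInduction_unitaryCharacter_cubic_archimedean`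
(`AutomorphicInductionUnitaryCharacterCubicArchimedean`: Jacquet–Piatetski-Shapiro–Shalika, the
non-normal cubic lifting `θ ↦ π(θ) = ⊗_v π(Ind θ)_v` on `GL₃(𝔸_F)` with its components at every
place, via the converse theorem for `GL(3)`; Gelbart 1997, Thm. 5.3.1 with Remark 5.3.1 (e)).

Clause (2) of the fact renders "the archimedean parameter of `θ`" as the archimedean parameter `χ`
of ANY automorphic representation datum `τ` of `GL₁(𝔸_E)` (Borel–Jacquet model) whose Satake
parameter at almost every `w` is `{θ(ϖ_w)}`, and is quantified over all such `(τ, χ)`.  This file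
proves that this quantification is harmless — every such `τ` has Hecke character `θ`, and the
archimedean parameter of a datum of `GL₁(𝔸_E)` is determined by its Hecke character — so that the
fact is equivalent to its EXISTENTIAL form, the shape in which any construction of `π(θ)` delivers
it (one realisation `τ` of `θ`, its parameter `χ`, and the induced parameter `σ ↦ ∑_{σ' ∣ σ} χ(σ')`
of `π(θ)`):

* `AutomorphicRepData.heckeCharacter_eq_of_eventually_hasSatakeParamAt_glOne` — **rigidity**: if
  `τ` (on `GL₁(𝔸_E)`) has Hecke character `χ` (`r(g) φ - χ(det g) φ ∈ W'`) and Satake parameter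
  `{θ(ϖ_w)}` at almost every `w`, then `χ = θ` (a Satake parameter of `τ` at `w` is `{χ(ϖ)}` for a
  uniformizer `ϖ`, `exists_eq_singleton_of_hasSatakeParamAt_glOne`; two Hecke characters with the
  same values at almost all uniformizers are equal, Cassels–Fröhlich VII Prop. 4.1,
  `HeckeCharacter.ext_of_eventually_valueAtUniformizer_eq`);
  `AutomorphicRepData.heckeCharacter_of_eventually_hasSatakeParamAt_glOne` — hence `θ` IS the Hecke
  character of `τ` (`exists_heckeCharacter_glOne`).
* `AutomorphicRepData.hasArchParameter_of_heckeCharacter_eq_glOne`,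
  `AutomorphicRepData.archParameter_eq_of_heckeCharacter_eq_glOne` — **the archimedean parameter of a
  datum of `GL₁(𝔸_E)` depends only on its Hecke character**: `𝔤𝔩₁(E_∞)` acts on the line `W / W'`
  through a real linear form `d` with `e^{t d(X)} = θ(det exp(tX))`
  (`heckeCharacter_glOne_det_ofArch_expMem`), so two realisations of `θ` have the same `d`, hence
  (`archParameter_clauses_glOne`, `hasArchParameter_glOne_of_eq_smul_one`) the same parameters.
* `automorphicInduction_unitaryCharacter_cubic_archimedean_iff_exists` — **the fact in existential
  form**: it holds iff for every cubic `E/F`, unitary `θ` with the regularity datum, and `hF`, there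
  are a cuspidal `π` on `GL₃(𝔸_F)` with the induced Satake polynomials almost everywhere, ONE
  realisation `τ` of `θ` on `GL₁(𝔸_E)` and ONE archimedean parameter `χ` of `τ` such that
  `σ ↦ ∑_{σ' ∣ σ} χ(σ')` is an archimedean parameter of `π`.

Nothing here discharges the fact (net debt unchanged): the existence of `π(θ)` is the converse
theorem for `GL(3)` (JPSS 1979, §§13–14), which has no carrier in the tree; see the seat notes and
the sibling `AutomorphicInductionUnitaryCharacterCubicResolventDescent` for why the cyclic theory of
Arthur–Clozel does not reach the non-normal cubic case.

## References

* H. Jacquet, I. I. Piatetski-Shapiro, J. Shalika, *Relèvement cubique non normal*, C. R. Acad.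
  Sci. Paris Sér. I 292 (1981), 567–571. [JPSS1981Cubique]
* S. Gelbart, *Three lectures on the modularity of `ρ̄_{E,3}` and the Langlands reciprocity
  conjecture* (1997), Thm. 5.3.1, Remark 5.3.1 (e), §7.2 p. 258. [Gelbart1997]
* S. Gelbart, *Automorphic forms on adele groups* (1975), §2.A (automorphic forms on `GL(1)` are
  Grössencharaktere). [Gelbart1975]
* J. W. S. Cassels, A. Fröhlich (eds.), *Algebraic Number Theory* (1967), Ch. VII §4, Prop. 4.1.
  [CasselsFrohlichANT1967]
* L. Clozel, *Motifs et formes automorphes* (1990), §3.3. [Clozel1990]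
-/

noncomputable section

open scoped NumberField Polynomial Classical
open NumberField IsDedekindDomain Polynomial Filter Literature.NumberTheory.Automorphic
open Literature.NumberTheory.GaloisRepresentations

namespace Literature.NumberTheory.Automorphic

/-! ### `GL₁`: a realisation of `θ` has Hecke character `θ` -/

section GLOne

variable {E : Type} [Field E] [NumberField E] {hE : isCompact_glFiniteIntegralLevel 1 E}

/-- **Rigidity of the Hecke character of a datum of `GL₁(𝔸_E)` from almost all Satake
parameters.**  If `τ = W / W'` has Hecke character `χ` (`r(g) φ - χ(det g) φ ∈ W'`) and Satake
parameter `{θ(ϖ_w)}` at almost every finite place `w`, then `χ = θ`: a Satake parameter of `τ` at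
`w` is `{χ(ϖ)}` for some uniformizer `ϖ` of `E_w` (`exists_eq_singleton_of_hasSatakeParamAt_glOne`),
which is `χ(ϖ_w)` wherever `χ` is unramified (almost everywhere), and two Hecke characters with the
same values at almost all uniformizers coincide (Cassels–Fröhlich VII, Prop. 4.1).
[cite: CasselsFrohlichANT1967, Ch. VII §4 Prop. 4.1] [cite: Gelbart1975, §2.A] -/
theorem AutomorphicRepData.heckeCharacter_eq_of_eventually_hasSatakeParamAt_glOne
    (τ : AutomorphicRepData (AutomorphyDatum.gl 1 E hE)) {χ : HeckeCharacter E}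
    (hχ : ∀ (g : (AdelicGroupData.gl 1 E).Adelic), ∀ φ ∈ τ.W,
      rightTranslation (AdelicGroupData.gl 1 E) g φ -
        ((χ (Matrix.GeneralLinearGroup.det g) : ℂˣ) : ℂ) • φ ∈ τ.W')
    {θ : HeckeCharacter E}
    (hτ : ∀ᶠ w : HeightOneSpectrum (𝓞 E) in cofinite, τ.HasSatakeParamAt w {θ.valueAtUniformizer w}) :
    χ = θ := by
  have hur : ∀ᶠ w : HeightOneSpectrum (𝓞 E) in cofinite, χ.IsUnramifiedAt w :=
    χ.finite_ramifiedPlaces_iff.1 (HeckeCharacter.finite_ramifiedPlaces_holds _)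
  refine HeckeCharacter.ext_of_eventually_valueAtUniformizer_eq ?_
  filter_upwards [hτ, hur] with w hw hu
  obtain ⟨ϖ, hϖ, heq⟩ := τ.exists_eq_singleton_of_hasSatakeParamAt_glOne hχ hw
  rw [Multiset.singleton_inj] at heq
  rw [heq, ← HeckeCharacter.localComponent_apply]
  exact (HeckeCharacter.localComponent_eq_valueAtUniformizer hu hϖ).symm

/-- **A realisation of `θ` on `GL₁(𝔸_E)` has Hecke character `θ`**: if `τ = W / W'` has Satake
parameter `{θ(ϖ_w)}` at almost every `w`, then every `g ∈ GL₁(𝔸_E)` acts on `W / W'` by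
`θ(det g)` (`exists_heckeCharacter_glOne` and the rigidity above).  Borel–Jacquet 1979, 4.6
(automorphic representations of `GL₁` are the Hecke characters); Gelbart 1975, §2.A.
[cite: Gelbart1975, §2.A] [cite: CasselsFrohlichANT1967, Ch. VII §4 Prop. 4.1] -/
theorem AutomorphicRepData.heckeCharacter_of_eventually_hasSatakeParamAt_glOne
    (τ : AutomorphicRepData (AutomorphyDatum.gl 1 E hE)) {θ : HeckeCharacter E}
    (hτ : ∀ᶠ w : HeightOneSpectrum (𝓞 E) in cofinite, τ.HasSatakeParamAt w {θ.valueAtUniformizer w}) :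
    ∀ (g : (AdelicGroupData.gl 1 E).Adelic), ∀ φ ∈ τ.W,
      rightTranslation (AdelicGroupData.gl 1 E) g φ -
        ((θ (Matrix.GeneralLinearGroup.det g) : ℂˣ) : ℂ) • φ ∈ τ.W' := by
  obtain ⟨χ, hχ⟩ := τ.exists_heckeCharacter_glOne
  obtain rfl := τ.heckeCharacter_eq_of_eventually_hasSatakeParamAt_glOne hχ hτ
  exact hχ

/-! ### `GL₁`: the archimedean parameter depends only on the Hecke character -/

/-- **Two data of `GL₁(𝔸_E)` with the same Hecke character have the same archimedean
parameters.**  `𝔤𝔩₁(E_∞)` acts on each line `W / W'` through a real linear form `d`, `d'`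
(`exists_linearMap_lieAction_eq_smul_one_glOne`) with `e^{t d(X)} = θ(det exp(tX)) = e^{t d'(X)}`
(`heckeCharacter_glOne_det_ofArch_expMem`), so `d = d'`; the parameter is read off `d` place by
place (`archParameter_clauses_glOne`, `hasArchParameter_glOne_of_eq_smul_one`).  Clozel 1990, §3.3
(`n = 1`: the parameter at `σ` of `π_θ` is that of `θ_σ`); Gelbart 1975, §2.A.
[cite: Clozel1990, §3.3] [cite: Gelbart1975, §2.A] -/
theorem AutomorphicRepData.hasArchParameter_of_heckeCharacter_eq_glOne
    (τ τ' : AutomorphicRepData (AutomorphyDatum.gl 1 E hE)) {θ : HeckeCharacter E}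
    (hθ : ∀ (g : (AdelicGroupData.gl 1 E).Adelic), ∀ φ ∈ τ.W,
      rightTranslation (AdelicGroupData.gl 1 E) g φ -
        ((θ (Matrix.GeneralLinearGroup.det g) : ℂˣ) : ℂ) • φ ∈ τ.W')
    (hθ' : ∀ (g : (AdelicGroupData.gl 1 E).Adelic), ∀ φ ∈ τ'.W,
      rightTranslation (AdelicGroupData.gl 1 E) g φ -
        ((θ (Matrix.GeneralLinearGroup.det g) : ℂˣ) : ℂ) • φ ∈ τ'.W')
    {χ : (E →+* ℂ) → Multiset ℂ} (hχ : τ.HasArchParameter χ) : τ'.HasArchParameter χ := by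
  obtain ⟨ρ, hρ⟩ := τ.exists_hasLieAction_gl
  obtain ⟨d, hd⟩ := τ.exists_linearMap_lieAction_eq_smul_one_glOne ρ
  obtain ⟨ρ', hρ'⟩ := τ'.exists_hasLieAction_gl
  obtain ⟨d', hd'⟩ := τ'.exists_linearMap_lieAction_eq_smul_one_glOne ρ'
  -- the two linear forms agree: both exponentiate to `θ(det exp(tX))`
  have hdd : d = d' := by
    refine LinearMap.ext fun X => eq_of_forall_cexp_mul_eq fun t => ?_
    rw [← τ.heckeCharacter_glOne_det_ofArch_expMem hθ X
        (fun φ hφ => τ.lieDeriv_sub_smul_mem_of_hasLieAction_glOne hρ hd X hφ) t,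
      ← τ'.heckeCharacter_glOne_det_ofArch_expMem hθ' X
        (fun φ hφ => τ'.lieDeriv_sub_smul_mem_of_hasLieAction_glOne hρ' hd' X hφ) t]
  subst hdd
  obtain ⟨hre, hco⟩ := τ.archParameter_clauses_glOne hρ d hd hχ
  exact τ'.hasArchParameter_glOne_of_eq_smul_one hρ' d hd' hre hco

/-- **The archimedean parameter of a datum of `GL₁(𝔸_E)` is determined by its Hecke character**:
if `τ`, `τ'` have the same Hecke character `θ` and archimedean parameters `χ`, `χ'`, then `χ = χ'`
(`hasArchParameter_of_heckeCharacter_eq_glOne` and uniqueness of archimedean parameters,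
`hasArchParameter_unique`).  Clozel 1990, §3.3. [cite: Clozel1990, §3.3] -/
theorem AutomorphicRepData.archParameter_eq_of_heckeCharacter_eq_glOne
    (τ τ' : AutomorphicRepData (AutomorphyDatum.gl 1 E hE)) {θ : HeckeCharacter E}
    (hθ : ∀ (g : (AdelicGroupData.gl 1 E).Adelic), ∀ φ ∈ τ.W,
      rightTranslation (AdelicGroupData.gl 1 E) g φ -
        ((θ (Matrix.GeneralLinearGroup.det g) : ℂˣ) : ℂ) • φ ∈ τ.W')
    (hθ' : ∀ (g : (AdelicGroupData.gl 1 E).Adelic), ∀ φ ∈ τ'.W,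
      rightTranslation (AdelicGroupData.gl 1 E) g φ -
        ((θ (Matrix.GeneralLinearGroup.det g) : ℂˣ) : ℂ) • φ ∈ τ'.W')
    {χ χ' : (E →+* ℂ) → Multiset ℂ} (hχ : τ.HasArchParameter χ) (hχ' : τ'.HasArchParameter χ') :
    χ = χ' :=
  τ'.hasArchParameter_unique (τ.hasArchParameter_of_heckeCharacter_eq_glOne τ' hθ hθ' hχ) hχ'

/-- **The archimedean parameter of a realisation of `θ` is intrinsic to `θ`**: two automorphic
representation data `τ`, `τ'` of `GL₁(𝔸_E)` with Satake parameter `{θ(ϖ_w)}` at almost every `w`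
have the same archimedean parameters.  (This is the sense in which clause (2) of
`automorphicInduction_unitaryCharacter_cubic_archimedean` speaks of "the archimedean parameter of
`θ`".)  Clozel 1990, §3.3; Borel–Jacquet 1979, 4.6. [cite: Clozel1990, §3.3] -/
theorem AutomorphicRepData.archParameter_eq_of_eventually_hasSatakeParamAt_glOne
    (τ τ' : AutomorphicRepData (AutomorphyDatum.gl 1 E hE)) {θ : HeckeCharacter E}
    (hτ : ∀ᶠ w : HeightOneSpectrum (𝓞 E) in cofinite, τ.HasSatakeParamAt w {θ.valueAtUniformizer w})
    (hτ' : ∀ᶠ w : HeightOneSpectrum (𝓞 E) in cofinite,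
      τ'.HasSatakeParamAt w {θ.valueAtUniformizer w})
    {χ χ' : (E →+* ℂ) → Multiset ℂ} (hχ : τ.HasArchParameter χ) (hχ' : τ'.HasArchParameter χ') :
    χ = χ' :=
  τ.archParameter_eq_of_heckeCharacter_eq_glOne τ'
    (τ.heckeCharacter_of_eventually_hasSatakeParamAt_glOne hτ)
    (τ'.heckeCharacter_of_eventually_hasSatakeParamAt_glOne hτ') hχ hχ'

/-- **Every Hecke character has a realisation on `GL₁(𝔸_E)` with an archimedean parameter**: a
datum `τ` with Satake parameter `{θ(ϖ_w)}` almost everywhere (`π_θ = ℂ·(θ∘det)/⊥`,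
`exists_automorphicRepData_hasSatakeParamAt_valueAtUniformizer`) and an archimedean parameter `χ`
of it (`exists_hasArchParameter_glOne`).  Borel–Jacquet 1979, 4.6; Clozel 1990, §3.3.
[cite: BorelJacquet1979, 4.6] [cite: Clozel1990, §3.3] -/
theorem exists_automorphicRepData_hasSatakeParamAt_hasArchParameter_glOne
    (hE : isCompact_glFiniteIntegralLevel 1 E) (θ : HeckeCharacter E) :
    ∃ (τ : AutomorphicRepData (AutomorphyDatum.gl 1 E hE)) (χ : (E →+* ℂ) → Multiset ℂ),
      (∀ᶠ w : HeightOneSpectrum (𝓞 E) in cofinite, τ.HasSatakeParamAt w {θ.valueAtUniformizer w}) ∧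
        τ.HasArchParameter χ := by
  obtain ⟨τ, hτ⟩ := exists_automorphicRepData_hasSatakeParamAt_valueAtUniformizer hE θ
  obtain ⟨χ, hχ⟩ := τ.exists_hasArchParameter_glOne
  exact ⟨τ, χ, hτ, hχ⟩

end GLOne

/-! ### The fact in existential form -/

/-- **Non-normal cubic automorphic induction with archimedean components, existential form.**  The
named fact `automorphicInduction_unitaryCharacter_cubic_archimedean` (Jacquet–Piatetski-Shapiro–
Shalika 1981; Gelbart 1997, Thm. 5.3.1 with Remark 5.3.1 (e)) holds iff: for every extension of
number fields `E/F` of degree `3` (not assumed Galois), every unitary Hecke character `θ` of `E`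
with the cuspidality datum (places `w ≠ w'` of `E` above one place of `F`, of the same residue
degree, unramified for `θ`, with `θ(ϖ_w) ≠ θ(ϖ_{w'})`) and every `hF`, there are a CUSPIDAL `π`
on `GL₃(𝔸_F)` with Satake polynomial `∏_{w ∣ v} (X^{f(w|v)} - θ(ϖ_w))` at almost every `v`, ONE
automorphic representation datum `τ` of `GL₁(𝔸_E)` with Satake parameter `{θ(ϖ_w)}` at almost
every `w` and ONE archimedean parameter `χ` of `τ` such that `σ ↦ ∑_{σ' ∣ σ} χ(σ')` is an
archimedean parameter of `π`.  (Forward: realise `θ` by `π_θ`,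
`exists_automorphicRepData_hasSatakeParamAt_hasArchParameter_glOne`.  Backward: any other
realisation `τ'` of `θ` has the same archimedean parameters,
`archParameter_eq_of_eventually_hasSatakeParamAt_glOne`; the compactness proofs `hE` typing the
data are equal by proof irrelevance.)  This is the shape in which a construction of `π(θ)` — the
converse theorem for `GL(3)` applied to the Hecke `L`-functions `L(s, θ · (ω ∘ N_{E/F}))` — delivers
the fact. [cite: JPSS1981Cubique] [cite: Gelbart1997, Thm. 5.3.1, Remark 5.3.1 (e) and §7.2 p. 258]
[cite: Clozel1990, §3.3] -/
theorem automorphicInduction_unitaryCharacter_cubic_archimedean_iff_exists :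
    automorphicInduction_unitaryCharacter_cubic_archimedean ↔
      ∀ (F E : Type) [Field F] [NumberField F] [Field E] [NumberField E] [Algebra F E],
        Module.finrank F E = 3 →
        ∀ (θ : GaloisRepresentations.HeckeCharacter E), θ.IsUnitary →
          ∀ (hF : isCompact_glFiniteIntegralLevel 3 F),
            (∃ (v : HeightOneSpectrum (𝓞 F)) (w w' : HeightOneSpectrum (𝓞 E)), w ≠ w' ∧
                w.under (𝓞 F) = v ∧ w'.under (𝓞 F) = v ∧
                w.asIdeal.inertiaDeg (𝓞 F) = w'.asIdeal.inertiaDeg (𝓞 F) ∧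
                θ.IsUnramifiedAt w ∧ θ.IsUnramifiedAt w' ∧
                θ.valueAtUniformizer w ≠ θ.valueAtUniformizer w') →
              ∃ π : CuspidalAutomorphicRepData 3 F hF,
                (∀ᶠ v : HeightOneSpectrum (𝓞 F) in cofinite, ∃ α : Multiset ℂ,
                  π.1.HasSatakeParamAt v α ∧
                    satakePolynomial α =
                      ∏ᶠ w ∈ {w : HeightOneSpectrum (𝓞 E) | w.under (𝓞 F) = v},
                        (X ^ w.asIdeal.inertiaDeg (𝓞 F) - C (θ.valueAtUniformizer w))) ∧
                ∃ (hE : isCompact_glFiniteIntegralLevel 1 E)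
                  (τ : AutomorphicRepData (AutomorphyDatum.gl 1 E hE)) (χ : (E →+* ℂ) → Multiset ℂ),
                  (∀ᶠ w : HeightOneSpectrum (𝓞 E) in cofinite,
                    τ.HasSatakeParamAt w {θ.valueAtUniformizer w}) ∧
                  τ.HasArchParameter χ ∧
                  π.1.HasArchParameter fun σ =>
                    ∑ σ' ∈ Finset.univ.filter (fun σ' : E →+* ℂ => σ'.comp (algebraMap F E) = σ),
                      χ σ' := by
  constructor
  · intro h F E _ _ _ _ _ h3 θ hθ hF hreg
    obtain ⟨π, hπ, harch⟩ := h F E h3 θ hθ hF hreg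
    obtain ⟨τ, χ, hτ, hχ⟩ := exists_automorphicRepData_hasSatakeParamAt_hasArchParameter_glOne
      (isCompact_glFiniteIntegralLevel_holds 1 E) θ
    exact ⟨π, hπ, _, τ, χ, hτ, hχ, harch _ τ hτ χ hχ⟩
  · intro h F E _ _ _ _ _ h3 θ hθ hF hreg
    obtain ⟨π, hπ, hE₀, τ₀, χ₀, hτ₀, hχ₀, harch⟩ := h F E h3 θ hθ hF hreg
    refine ⟨π, hπ, fun hE τ hτ χ hχ => ?_⟩
    obtain rfl : hE = hE₀ := rfl
    obtain rfl : χ = χ₀ :=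
      τ.archParameter_eq_of_eventually_hasSatakeParamAt_glOne τ₀ hτ hτ₀ hχ hχ₀
    exact harch

/-- **Consequence for consumers**: granting the fact, the cuspidal `π(θ)` it provides carries the
induced parameter `σ ↦ ∑_{σ' ∣ σ} χ(σ')` for the archimedean parameter `χ` of ANY realisation `τ`
of `θ` — in particular of the canonical one `π_θ` — and that parameter does not depend on the
realisation chosen (`archParameter_eq_of_eventually_hasSatakeParamAt_glOne`).  Restated from
`automorphicInduction_unitaryCharacter_cubic_archimedean.exists_cuspidal_archParameter` with the
realisation produced rather than supplied. [cite: JPSS1981Cubique] [cite: Clozel1990, §3.3] -/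
theorem automorphicInduction_unitaryCharacter_cubic_archimedean.exists_cuspidal_exists_archParameter
    (h : automorphicInduction_unitaryCharacter_cubic_archimedean)
    {F E : Type} [Field F] [NumberField F] [Field E] [NumberField E] [Algebra F E]
    (h3 : Module.finrank F E = 3) (θ : GaloisRepresentations.HeckeCharacter E) (hθ : θ.IsUnitary)
    (hreg : ∃ (v : HeightOneSpectrum (𝓞 F)) (w w' : HeightOneSpectrum (𝓞 E)), w ≠ w' ∧
      w.under (𝓞 F) = v ∧ w'.under (𝓞 F) = v ∧
      w.asIdeal.inertiaDeg (𝓞 F) = w'.asIdeal.inertiaDeg (𝓞 F) ∧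
      θ.IsUnramifiedAt w ∧ θ.IsUnramifiedAt w' ∧
      θ.valueAtUniformizer w ≠ θ.valueAtUniformizer w')
    (hF : isCompact_glFiniteIntegralLevel 3 F) (hE : isCompact_glFiniteIntegralLevel 1 E) :
    ∃ (π : CuspidalAutomorphicRepData 3 F hF) (τ : AutomorphicRepData (AutomorphyDatum.gl 1 E hE))
      (χ : (E →+* ℂ) → Multiset ℂ),
      (∀ᶠ v : HeightOneSpectrum (𝓞 F) in cofinite, ∃ α : Multiset ℂ,
        π.1.HasSatakeParamAt v α ∧
          satakePolynomial α =
            ∏ᶠ w ∈ {w : HeightOneSpectrum (𝓞 E) | w.under (𝓞 F) = v},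
              (X ^ w.asIdeal.inertiaDeg (𝓞 F) - C (θ.valueAtUniformizer w))) ∧
      (∀ᶠ w : HeightOneSpectrum (𝓞 E) in cofinite, τ.HasSatakeParamAt w {θ.valueAtUniformizer w}) ∧
      τ.HasArchParameter χ ∧
      π.1.HasArchParameter fun σ =>
        ∑ σ' ∈ Finset.univ.filter (fun σ' : E →+* ℂ => σ'.comp (algebraMap F E) = σ), χ σ' := by
  obtain ⟨τ, χ, hτ, hχ⟩ := exists_automorphicRepData_hasSatakeParamAt_hasArchParameter_glOne hE θ
  obtain ⟨π, hπ, harch⟩ := h.exists_cuspidal_archParameter h3 θ hθ hreg hF τ hτ hχ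
  exact ⟨π, τ, χ, hπ, hτ, hχ, harch⟩

end Literature.NumberTheory.Automorphic

end
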